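import Summits.ResolutionOfSingularities.ResolutionOfSingularities.Theorems.WildConesConeExit
import Summits.ResolutionOfSingularities.ResolutionOfSingularities.Theorems.WildConesNarrowRunsDie
import Summits.ResolutionOfSingularities.ResolutionOfSingularities.Theses.FrobeniusClosing
import Summits.ResolutionOfSingularities.ResolutionOfSingularities.Theses.JacobianBudget
import Summits.ResolutionOfSingularities.ResolutionOfSingularities.Theses.EscapeRate
import HarnessLib

/-!
# `WildCones.Assembly` (stmt-ResolutionOfSingularities-16886) — PROVED, and the ENGINE as a theorem:
# `ClassicalRegimes → IsolatedForcedTermination` (target stmt-ResolutionOfSingularities-16343)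

Route `ResolutionOfSingularities/WildCones`. The route's assembly item is the implication
`ConeExit → NarrowRunsDie → ClassicalRegimes → IsolatedForcedTermination` (the ENGINE of the route file's
deciding theorem `closes`): along a run all of whose states are isolated of multiplicity `p`,

* if `n ≤ 2 ∨ p = 2` the run is excluded by `ClassicalRegimes` (crux stmt-16884);
* otherwise `p` is odd and `n ≥ 3`, the one-step cone exit lemma `ConeExit` (crux stmt-16883) applied at
  every step `run m ↦ run (m+1) = step (i m) (t m) (run m)` (a `ζ/ι`-reduction of the shared `let`-bound
  `Nat.rec`, so no lemma is needed) puts every state on the ridge — cleaned order exactly `p` and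
  cone-invariance rank `dL = 1` — and such narrow runs are excluded by `NarrowRunsDie` (crux stmt-16882).

Both `ConeExit` (`Theorems.WildConesConeExit.ConeExit_proof`) and `NarrowRunsDie`
(`Theorems.NarrowRunsDie_proof`) are THEOREMS of the tree (2026-08-17), so the engine specialises to
`isolatedForcedTermination_of_classicalRegimes : ClassicalRegimes → IsolatedForcedTermination`, and — the
converse being restriction — to the equivalence `isolatedForcedTermination_iff_classicalRegimes`: the target
`IsolatedForcedTermination` (stmt-16343, shared verbatim by the routes `FrobeniusClosing`, `WildCones`,
`JacobianBudget`, `EscapeRate`) is now EXACTLY the classical-regimes statement (`n ≤ 2 ∨ p = 2`).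
The four route files inline the same `let`-calculus, so their copies of `IsolatedForcedTermination` agree
definitionally (`Iff.rfl` bridges below) and the reduction is recorded once for each copy.

This file replaces the role of no printed item; it is OURS (campaign res-hironaka, rung L, slot W4.1):
a kernel assembly of statements of this tree, NOT a statement of any manuscript.
-/

noncomputable section

-- single-problem summit: the doubled namespace component `ResolutionOfSingularities` is forced
set_option linter.dupNamespace false

namespace Summit.ResolutionOfSingularities.ResolutionOfSingularities.Theorems.WildCones

open Summit.ResolutionOfSingularities.ResolutionOfSingularities.Theses.WildCones
  (IsolatedForcedTermination NarrowRunsDie ConeExit ClassicalRegimes Assembly)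

/-- **The ENGINE of route `WildCones`**: the one-step cone exit lemma, the death of narrow runs and the
classical regimes together exclude every run of the point-blow-up dynamics of a height-one atom
`z^p = a(u₁,…,uₙ)` over a perfect field all of whose states are isolated of multiplicity `p`.
Case split `n ≤ 2 ∨ p = 2` (classical regimes) / `p` odd, `n ≥ 3` (cone exit at every step feeds
`NarrowRunsDie`); `run (m+1)` is `step (i m) (t m) (run m)` by `ζ/ι`-reduction of the shared calculus.
This is the term `engine`/`hI` of the route file's `closes`, extracted as a theorem.
[cite: HauserPerlega2019, §1 p. 3 (the forced-cycle question this answers for odd p modulo the classical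
regimes)] -/
theorem engine (hC : ConeExit) (hN : NarrowRunsDie) (hR : ClassicalRegimes) : IsolatedForcedTermination :=
  fun p hp n hn κ _ _ _ c₀ i t =>
    if h : n ≤ 2 ∨ p = 2 then hR p hp n hn h κ c₀ i t
    else fun hall =>
      hN p hp (fun h2 => h (Or.inr h2)) n (by omega) κ c₀ i t hall
        (fun m => hC p hp (fun h2 => h (Or.inr h2)) n (by omega) κ _ (i m) (t m)
          (hall m).1 (hall m).2 (hall (m + 1)).1 (hall (m + 1)).2)

/-- **`WildCones.Assembly` (item stmt-ResolutionOfSingularities-16886) holds**: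
`ConeExit → NarrowRunsDie → ClassicalRegimes → IsolatedForcedTermination` is the engine. -/
theorem assembly_proof : Assembly :=
  fun hC hN hR => engine hC hN hR

/-- **The target modulo the classical regimes.** With `ConeExit` (`WildConesConeExit.ConeExit_proof`) and
`NarrowRunsDie` (`NarrowRunsDie_proof`) proved in the tree, `ClassicalRegimes` (crux stmt-16884:
`n ≤ 2 ∨ p = 2`) alone implies the target `IsolatedForcedTermination` (stmt-16343). -/
theorem isolatedForcedTermination_of_classicalRegimes (hR : ClassicalRegimes) : IsolatedForcedTermination :=
  engine WildConesConeExit.ConeExit_proof NarrowRunsDie_proof hR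

/-- The converse is restriction: the target restricted to `n ≤ 2 ∨ p = 2` IS `ClassicalRegimes`. -/
theorem classicalRegimes_of_isolatedForcedTermination (hI : IsolatedForcedTermination) : ClassicalRegimes :=
  fun p hp n hn _ κ _ _ _ c₀ i t => hI p hp n hn κ c₀ i t

/-- **Reduction of the target to the classical regimes, as an equivalence**: given the two landed engine
theorems, `IsolatedForcedTermination ↔ ClassicalRegimes` — what is left of the target (for all four routes
sharing it) is exactly the statement for `n ≤ 2 ∨ p = 2`. -/
theorem isolatedForcedTermination_iff_classicalRegimes : IsolatedForcedTermination ↔ ClassicalRegimes :=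
  ⟨classicalRegimes_of_isolatedForcedTermination, isolatedForcedTermination_of_classicalRegimes⟩

/-! ## The same reduction for the verbatim copies of the target in the sibling route files
(item stmt-ResolutionOfSingularities-16343 is wanted, with the identical signature, by `FrobeniusClosing`,
`JacobianBudget` and `EscapeRate`; the inlined `let`-calculi agree definitionally). -/

/-- `FrobeniusClosing.IsolatedForcedTermination` is `WildCones.IsolatedForcedTermination` (definitionally). -/
theorem frobeniusClosing_isolatedForcedTermination_iff :
    Theses.FrobeniusClosing.IsolatedForcedTermination ↔ IsolatedForcedTermination :=
  Iff.rfl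

/-- `JacobianBudget.IsolatedForcedTermination` is `WildCones.IsolatedForcedTermination` (definitionally). -/
theorem jacobianBudget_isolatedForcedTermination_iff :
    Theses.JacobianBudget.IsolatedForcedTermination ↔ IsolatedForcedTermination :=
  Iff.rfl

/-- `EscapeRate.IsolatedForcedTermination` is `WildCones.IsolatedForcedTermination` (definitionally). -/
theorem escapeRate_isolatedForcedTermination_iff :
    Theses.EscapeRate.IsolatedForcedTermination ↔ IsolatedForcedTermination :=
  Iff.rfl

/-- Route `FrobeniusClosing`'s target (stmt-16343) from `WildCones.ClassicalRegimes` alone. -/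
theorem frobeniusClosing_isolatedForcedTermination_of_classicalRegimes (hR : ClassicalRegimes) :
    Theses.FrobeniusClosing.IsolatedForcedTermination :=
  frobeniusClosing_isolatedForcedTermination_iff.mpr (isolatedForcedTermination_of_classicalRegimes hR)

/-- Route `JacobianBudget`'s target (stmt-16343) from `WildCones.ClassicalRegimes` alone. -/
theorem jacobianBudget_isolatedForcedTermination_of_classicalRegimes (hR : ClassicalRegimes) :
    Theses.JacobianBudget.IsolatedForcedTermination :=
  jacobianBudget_isolatedForcedTermination_iff.mpr (isolatedForcedTermination_of_classicalRegimes hR)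

/-- Route `EscapeRate`'s target (stmt-16343) from `WildCones.ClassicalRegimes` alone. -/
theorem escapeRate_isolatedForcedTermination_of_classicalRegimes (hR : ClassicalRegimes) :
    Theses.EscapeRate.IsolatedForcedTermination :=
  escapeRate_isolatedForcedTermination_iff.mpr (isolatedForcedTermination_of_classicalRegimes hR)

end Summit.ResolutionOfSingularities.ResolutionOfSingularities.Theorems.WildCones

end
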